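import Literature.Barriers.SmoothPoincare4.HCobordismTheoremFails
import Literature.Barriers.SmoothPoincare4.SmallExoticaFrontier
import Literature.Topology.FourManifolds.SmoothIntersectionForms
import Literature.AlgebraicTopology.SingularHomology.FundamentalClassProofs
import Literature.AlgebraicTopology.SingularHomology.OrientationCover
import Literature.Topology.FourManifolds.HCobordismDonaldson
import HarnessLib

/-!
# `Literature.Barriers.SmoothPoincare4.HCobordismBarrierFour`: what an unconditional proof must contain

Proof file (sibling of `Literature.Barriers.SmoothPoincare4.HCobordismTheoremFails`) for the
named barrier `Literature.Barriers.HCobordismBarrierFour := ¬ HCobordismPrincipleFour` ("the smooth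
h-cobordism principle fails in dimension 4"). The barrier file proves it *relative* to the tree's
named fact `Literature.Topology.FourManifolds.exists_isHCobordant_isEmpty_diffeomorph_four` (Donaldson's counterexample,
hypothesis `hD` of `hCobordismBarrierFour_of_donaldson`, D-0014). This file records the triage of
its unconditional discharge: the barrier is **equivalent** to that named fact
(`hCobordismBarrierFour_iff_exists_isHCobordant_isEmpty_diffeomorph`), so no leaf smaller than
Donaldson's theorem can suffice, and the discharge is of size XL (gauge theory).

## The printed proof of the leaf (S. K. Donaldson, *Irrationality and the h-cobordism
conjecture*, J. Differential Geom. 26 (1987) 141–168)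

* p. 142: "Wall showed in [30] that there is an h-cobordism between two simply connected,
  homotopy equivalent 4-manifolds. So `Z` and `P² # 9P̄²` are h-cobordant nondiffeomorphic
  manifolds and they give a counterexample to the 'h-cobordism conjecture' for smooth
  4-manifolds. That is, the failure of the usual proof of the h-cobordism theorem is irreparable."
* §II (pp. 143–152): for a smooth simply connected closed oriented 4-manifold `X` with
  intersection form of type `(1, n)`, the invariant `Γ_X : 𝒞_X → H²(X; ℤ)`, a function on the set
  `𝒞_X` of chambers into which the walls `W_e = e^⊥ ∩ Ω`, `e · e = -1`, cut the positive cone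
  `Ω` of `H²(X; ℝ)` (2.1), with the formal properties (2.2): (i) `Γ_X(-C) = -Γ_X(C)`, (ii) a
  wall-crossing formula, (iii) `Γ_{X₁}(f^*(C)) = f^*(Γ_{X₂}(C))` for an orientation preserving
  diffeomorphism `f : X₁ → X₂`; it is defined from the moduli space of `g`-anti-self-dual `SU(2)`
  connections with `c₂ = 1`: Thm. (2.15) (p. 152) "There is a unique way to define a map
  `Γ_X : 𝒞_X → H²(X; ℤ)` with the three properties in (2.2) such that for any generic metric `g`
  on `X` and `g`-self-dual form `ω`, `Γ_X(C) = Γ(g, ω)`, where `C` is the chamber containing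
  `[ω]`."
* §III: on an algebraic surface ASD moduli spaces are moduli of stable bundles (Prop. (3.5),
  p. 154) and `Γ_X(C)` is computed from them (Props. (3.12), (3.13), pp. 157–158); `Y = P² # 9P̄²`
  is the rational elliptic surface and Dolgachev's surface `Z` is obtained from it by logarithmic
  transformations of multiplicities `2` and `3`. Prop. (3.16)(ii) (p. 159): "The 4-manifold
  underlying `Z` is simply connected and homotopy equivalent, smoothly h-cobordant and
  homeomorphic to that underlying `Y`" — "using the classification of forms [28] and the theorems
  of Milnor [21], Wall [29], and Freedman [11]" (p. 160); the h-cobordism is Wall 1964, Thm. 2: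
  "Two simply-connected closed 4-manifolds with isomorphic quadratic forms are h-cobordant"
  (J. London Math. Soc. 39, p. 141, proof §2 p. 144). Cor. (3.20) (p. 161): "There are no stable
  bundles `ℰ` with `c₂(ℰ) = 1`, `Λ²(ℰ) = 𝒪_Y` over the rational surface `Y`"; Thm. (3.21)
  (p. 161): over `Z` the moduli space of such bundles is the multiple fibre `F₂`, with universal
  family whose `c₂` is Poincaré dual to `Δ_{F₂}`. Thm. (3.24) (p. 163): "The Dolgachev surface `Z`
  is not diffeomorphic to the rational surface `Y`" — proof p. 163: `Γ_Y(C_Y)` is a multiple of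
  `c₁(K_Y)` "since the moduli space is empty", while `Γ_Z(C_Z) = c₁(K_Z) + 2 P.D.(F₂)`; by "a
  theorem of Wall [30, Theorem 2]" the diffeomorphisms of `Y` act transitively on chambers, so a
  diffeomorphism `f : Y → Z` may be assumed to satisfy `f^*(C_Z) = C_Y`; then `Γ_Y(C_Y) · ω_Y < 0`
  for every `ω_Y ∈ C_Y` while `Γ_Z(C_Z) · ω_Z > 0` for every `ω_Z ∈ C_Z`, "This contradicts the
  existence of `f`."

## What is proved here, and what remains a named fact

* PROVED: `hCobordismBarrierFour_iff_exists_isHCobordant_isEmpty_diffeomorph` — the barrier is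
  equivalent to `Literature.Topology.FourManifolds.exists_isHCobordant_isEmpty_diffeomorph_four`; the two repackagings
  `HCobordismBarrierFour.exists_isHCobordant_isEmpty_diffeomorph` and
  `hCobordismPrincipleFour_iff_not_exists`.
* PROVED, the inference printed on p. 142 of Donaldson 1987 ("Wall showed in [30] that there is an
  h-cobordism between two simply connected, homotopy equivalent 4-manifolds. So `Z` and `P² # 9P̄²`
  are h-cobordant nondiffeomorphic manifolds"), in its *homeomorphic* form and relative to Wall's
  theorem as the tree's named fact `Literature.Topology.FourManifolds.isHCobordant_and_exists_isStabilization`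
  (hypothesis `hW`): `isHCobordant_of_homeomorph_of_wall` (homeomorphic simply connected closed
  smooth 4-manifolds are smoothly h-cobordant: a `ℤ`-orientation exists on a simply connected
  manifold, `Literature.AlgebraicTopology.SingularHomology.isOrientableOver_of_simplyConnectedSpace`, the transported orientation has an
  isometric intersection form, `Literature.AlgebraicTopology.SingularHomology.equivalent_intersectionForm_comap` with the discharged
  `Literature.AlgebraicTopology.SingularHomology.HomologicalOrientation.fundamentalClass_comap_holds`, and Wall's Thm. 2 applies);
  `exists_isHCobordant_isEmpty_diffeomorph_four_of_homeomorph` and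
  `hCobordismBarrierFour_of_homeomorph_of_isEmpty_diffeomorph` (ANY pair of homeomorphic,
  non-diffeomorphic simply connected closed smooth 4-manifolds yields Donaldson's existence
  statement, hence the barrier, given `hW`); and `hCobordismBarrierFour_of_wall_of_akhmedovPark`, a
  second derivation of the barrier from tree facts only — Wall 1964 Thm. 2 and the Akhmedov–Park
  exotic family on `P² # 2P̄²` (`Literature.Barriers.SmoothPoincare4.akhmedovPark2010_exotic_bTwo_three`, sibling entry
  `SmallExoticaFrontier.lean`) in place of Donaldson's pair.
* REMAINS (leaves of the discharge DAG, all XL or L and none with Mathlib support): EITHER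
  `Literature.Topology.FourManifolds.exists_isHCobordant_isEmpty_diffeomorph_four` itself = Donaldson 1987 Prop. (3.16)(ii)
  + Thm. (3.24) — the Dolgachev surface and `P² # 9P̄²` as smooth 4-manifolds with their elliptic
  fibrations, Yang–Mills moduli spaces (Uhlenbeck compactness, transversality, orientations), the
  `Γ`-invariant with its wall-crossing formula, the identification of ASD moduli with stable
  bundles (Prop. (3.5)) and the stable-bundle computations Cor. (3.20), Thm. (3.21); OR the pair
  {Wall 1964 Thm. 2 (`hW`: 5-dimensional surgery making `M₁ # (-M₂)` bound a simply connected
  `W⁵` of the homotopy type of a bouquet of 2-spheres, Wall 1964 Thm. 1 and §2), an exotic pair of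
  homeomorphic simply connected closed smooth 4-manifolds (gauge theory again: Donaldson 1987, or
  the Seiberg–Witten computation of Akhmedov–Park 2010, Lemma 8)}.

## The leaf census as theorems (2026-08-15)

Donaldson's fact is itself decomposed in the tree along the printed argument
(`Literature/Topology/FourManifolds/HCobordismDonaldson.lean`) into (A) Wall 1964, Thm. 2 ALONE
(`Literature.Topology.FourManifolds.isHCobordant_of_equivalent_intersectionForm`) and (B) the
existence of an exotic pair of simply connected closed smooth 4-manifolds
(`Literature.Topology.FourManifolds.exists_homeomorph_isEmpty_diffeomorph_four`; Donaldson 1987,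
Prop. (3.16)(ii) + Thm. (3.24), proved there from the Akhmedov–Park family). This file now records
what that means for the barrier, all PROVED:

* `hCobordismBarrierFour_of_wallThmTwo_of_exoticPair : (A) → (B) → HCobordismBarrierFour` — the
  barrier from the two finest current leaves (Donaldson 1987, p. 142: "Wall showed in [30] that
  there is an h-cobordism between two simply connected, homotopy equivalent 4-manifolds. So `Z`
  and `P² # 9P̄²` are h-cobordant nondiffeomorphic manifolds");
* `HCobordismBarrierFour.exists_homeomorph_isEmpty_diffeomorph_of_freedman` — conversely, GIVEN
  Freedman's theorem (tree fact `Literature.Topology.FourManifolds.nonempty_homeomorph_of_isHCobordant_four`: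
  h-cobordant simply connected closed smooth 4-manifolds are homeomorphic; Freedman 1982,
  Thm. 1.3; "by Freedman's classification [11] the two manifolds are homeomorphic", Donaldson
  1987, p. 142), any proof of the barrier yields an exotic pair;
* `hCobordismBarrierFour_iff_exists_homeomorph_isEmpty_diffeomorph` — hence, MODULO the two
  classical theorems of Wall (1964, Thm. 2) and Freedman (1982, Thm. 1.3), the barrier is
  EQUIVALENT to (B): an unconditional `HCobordismBarrierFour_holds` must construct an exotic pair of
  simply connected closed smooth 4-manifolds and cannot consist of less (size XL: every published
  proof of (B) is gauge-theoretic — Donaldson's `Γ`-invariant, or Seiberg–Witten invariants as in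
  Akhmedov–Park 2010, Lemma 8);
* `HCobordismPrincipleFour.nonempty_diffeomorph_sphere_of_thetaFour` — on the Kervaire–Milnor side,
  `π₁(S⁴) = 1` is now a tree THEOREM (`Literature.Topology.FourManifolds.simplyConnectedSpace_sphere_four_holds`),
  so the only hypothesis left in "the principle would prove every homotopy 4-sphere `≅ S⁴`"
  (`HCobordismPrincipleFour.nonempty_diffeomorph_sphere`) is `Θ₄ = 0` in the h-cobordism sense
  (`Literature.Topology.FourManifolds.isHCobordant_sphere_of_homotopySphere_four`). In Kervaire–Milnor,
  *Groups of homotopy spheres I*, Ann. of Math. 77 (1963), this is the entry `n = 4 ↦ 1` of the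
  table of orders of `Θₙ` on p. 504, proved in Part I from Thm. 3.1 (homotopy spheres are
  s-parallelizable), §4 (p. 512: `Θₙ / bPₙ₊₁ ↪ Πₙ / p(Sⁿ)`, table for `n ≤ 8`), Thm. 5.1 (p. 512:
  a homotopy `2k`-sphere bounding an s-parallelizable manifold bounds a contractible one, so
  `bP₅ = 0`) and Lemma 2.3 (p. 506: bounding a contractible manifold ⇔ h-cobordant to `Sⁿ`);
  Thm. 1.1 (p. 504) is the group structure of `Θₙ` only. (Tree decomposition of this fact:
  `Literature/Topology/FourManifolds/ThetaFourKervaireMilnor.lean`.)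

## References

[DonaldsonIrrationality1987] [WallJLMS1964] [AkhmedovPark2010] [MilnorHusemoller1973]
[HatcherAT2002] [KervaireMilnorAnnals1963] [FreedmanJDG1982]
-/

noncomputable section

open scoped Manifold ContDiff

namespace Literature.Barriers.SmoothPoincare4

/-- **The barrier is equivalent to the existence of Donaldson's counterexample.**
`HCobordismBarrierFour` (`¬ HCobordismPrincipleFour`) holds if and only if there exist simply
connected closed smooth 4-manifolds `M`, `N` (in `Type`) with `IsHCobordant 4 M N` and
`IsEmpty (M ≃ₘ⟮𝓡 4, 𝓡 4⟯ N)`, i.e. iff the tree's named fact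
`Literature.Topology.FourManifolds.exists_isHCobordant_isEmpty_diffeomorph_four` holds. The direction `←` is
`hCobordismBarrierFour_of_donaldson`; `→` is classical logic (a failure of the universally
quantified principle is a witness pair). The right-hand side is printed as Donaldson 1987,
Prop. (3.16)(ii) and Thm. (3.24) (`Y = P² # 9P̄²`, `Z` the Dolgachev surface: simply connected,
smoothly h-cobordant, not diffeomorphic), the h-cobordism coming from Wall 1964, Thm. 2.
[cite: DonaldsonIrrationality1987, Prop. (3.16)(ii) p. 159 and Thm. (3.24) p. 163]
[cite: WallJLMS1964, Thm. 2 (p. 141)] -/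
theorem hCobordismBarrierFour_iff_exists_isHCobordant_isEmpty_diffeomorph :
    HCobordismBarrierFour ↔ Literature.Topology.FourManifolds.exists_isHCobordant_isEmpty_diffeomorph_four := by
  refine ⟨fun hB => ?_, hCobordismBarrierFour_of_donaldson⟩
  by_contra hD
  refine hB fun M N _ _ _ _ _ _ _ _ _ _ _ _ _ _ hMN => ?_
  by_contra hne
  exact hD ⟨M, N, ‹_›, ‹_›, ‹_›, ‹_›, ‹_›, ‹_›, ‹_›, ‹_›, ‹_›, ‹_›, ‹_›, ‹_›, ‹_›, ‹_›, hMN,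
    ⟨fun e => hne ⟨e⟩⟩⟩

/-- **A proof of the barrier is a counterexample pair** (dot-notation form of
`hCobordismBarrierFour_iff_exists_isHCobordant_isEmpty_diffeomorph`, direction `→`): from
`HCobordismBarrierFour` one extracts simply connected closed smooth 4-manifolds `M`, `N`, smoothly
h-cobordant and not diffeomorphic — the shape of Donaldson's pair `(P² # 9P̄², Z)`.
[cite: DonaldsonIrrationality1987, Prop. (3.16)(ii) and Thm. (3.24)] -/
theorem HCobordismBarrierFour.exists_isHCobordant_isEmpty_diffeomorph (h : HCobordismBarrierFour) :
    Literature.Topology.FourManifolds.exists_isHCobordant_isEmpty_diffeomorph_four :=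
  hCobordismBarrierFour_iff_exists_isHCobordant_isEmpty_diffeomorph.mp h

/-- **The h-cobordism principle in dimension 4 is the negation of Donaldson's existence
statement**: `HCobordismPrincipleFour` holds iff there is NO pair of simply connected closed smooth
h-cobordant non-diffeomorphic 4-manifolds (contrapositive packaging of
`hCobordismBarrierFour_iff_exists_isHCobordant_isEmpty_diffeomorph`; Donaldson 1987, p. 142: such a
pair is "a counterexample to the 'h-cobordism conjecture' for smooth 4-manifolds").
[cite: DonaldsonIrrationality1987, p. 142] -/
theorem hCobordismPrincipleFour_iff_not_exists :
    HCobordismPrincipleFour ↔ ¬ Literature.Topology.FourManifolds.exists_isHCobordant_isEmpty_diffeomorph_four := by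
  rw [← hCobordismBarrierFour_iff_exists_isHCobordant_isEmpty_diffeomorph]
  exact ⟨fun h hB => hB h, fun h => Classical.not_not.mp h⟩

/-! ### Donaldson's p. 142 inference: an exotic pair plus Wall's theorem refutes the principle -/

/-- **Homeomorphic simply connected closed smooth 4-manifolds are smoothly h-cobordant, GIVEN
Wall's theorem** (the tree's named fact `Literature.Topology.FourManifolds.isHCobordant_and_exists_isStabilization`,
hypothesis `hW`; Wall 1964, Thm. 2: "Two simply-connected closed 4-manifolds with isomorphic
quadratic forms are h-cobordant"). This is the homeomorphic form of the inference on p. 142 of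
Donaldson 1987 ("Wall showed in [30] that there is an h-cobordism between two simply connected,
homotopy equivalent 4-manifolds"): `N` is simply connected, hence `ℤ`-orientable
(`Literature.AlgebraicTopology.SingularHomology.isOrientableOver_of_simplyConnectedSpace`, Hatcher Prop. 3.25); transporting an orientation
`ν` of `N` along `e : M ≃ₜ N` gives an isometry of intersection forms
`Q_{(M, ν.comap e)} ≅ Q_{(N, ν)}` (`Literature.AlgebraicTopology.SingularHomology.equivalent_intersectionForm_comap`, with the discharged
naturality of the fundamental class
`Literature.AlgebraicTopology.SingularHomology.HomologicalOrientation.fundamentalClass_comap_holds`; Milnor–Husemoller §V.1), and Wall's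
Thm. 2 applies. [cite: WallJLMS1964, Thm. 2 (p. 141)] [cite: DonaldsonIrrationality1987, p. 142]
[cite: MilnorHusemoller1973, §V.1] -/
theorem isHCobordant_of_homeomorph_of_wall (hW : Literature.Topology.FourManifolds.isHCobordant_and_exists_isStabilization)
    (M N : Type) [TopologicalSpace M] [T2Space M] [SecondCountableTopology M]
    [ChartedSpace (EuclideanSpace ℝ (Fin 4)) M] [IsManifold (𝓡 4) ∞ M] [CompactSpace M]
    [SimplyConnectedSpace M] [TopologicalSpace N] [T2Space N] [SecondCountableTopology N]
    [ChartedSpace (EuclideanSpace ℝ (Fin 4)) N]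
    [IsManifold (𝓡 4) ∞ N] [CompactSpace N] [SimplyConnectedSpace N] (e : M ≃ₜ N) :
    Literature.Topology.FourManifolds.IsHCobordant 4 M N := by
  obtain ⟨ν⟩ := Literature.AlgebraicTopology.SingularHomology.isOrientableOver_of_simplyConnectedSpace ℤ N (n := 4)
  exact (hW M N (ν.comap e) ν (Literature.AlgebraicTopology.SingularHomology.equivalent_intersectionForm_comap
    (Literature.AlgebraicTopology.SingularHomology.HomologicalOrientation.fundamentalClass_comap_holds ℤ N M 4) two_add_two_eq_four ν e)).1

/-- **An exotic pair yields Donaldson's existence statement, GIVEN Wall's theorem.** If `M`, `N`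
are homeomorphic, non-diffeomorphic closed smooth 4-manifolds with `M` simply connected, then
(Wall 1964, Thm. 2, hypothesis `hW`) they are smoothly h-cobordant, simply connected and not
diffeomorphic: the tree's named fact `Literature.Topology.FourManifolds.exists_isHCobordant_isEmpty_diffeomorph_four`
holds. With `(M, N) = (P² # 9P̄², Z)` this is exactly how Donaldson 1987, p. 142 obtains the
counterexample from Thm. (3.24) and Prop. (3.16)(ii).
[cite: DonaldsonIrrationality1987, p. 142 and Prop. (3.16)(ii)] [cite: WallJLMS1964, Thm. 2] -/
theorem exists_isHCobordant_isEmpty_diffeomorph_four_of_homeomorph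
    (hW : Literature.Topology.FourManifolds.isHCobordant_and_exists_isStabilization)
    (M N : Type) [TopologicalSpace M] [T2Space M] [SecondCountableTopology M]
    [ChartedSpace (EuclideanSpace ℝ (Fin 4)) M] [IsManifold (𝓡 4) ∞ M] [CompactSpace M]
    [SimplyConnectedSpace M] [TopologicalSpace N] [T2Space N] [SecondCountableTopology N]
    [ChartedSpace (EuclideanSpace ℝ (Fin 4)) N]
    [IsManifold (𝓡 4) ∞ N] [CompactSpace N] (e : M ≃ₜ N) (hE : IsEmpty (M ≃ₘ⟮𝓡 4, 𝓡 4⟯ N)) :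
    Literature.Topology.FourManifolds.exists_isHCobordant_isEmpty_diffeomorph_four := by
  haveI : SimplyConnectedSpace N := e.symm.toHomotopyEquiv.simplyConnectedSpace
  exact ⟨M, N, ‹_›, ‹_›, ‹_›, ‹_›, ‹_›, ‹_›, ‹_›, ‹_›, ‹_›, ‹_›, ‹_›, ‹_›, ‹_›, ‹_›,
    isHCobordant_of_homeomorph_of_wall hW M N e, hE⟩

/-- **Any exotic pair of simply connected closed smooth 4-manifolds refutes the h-cobordism
principle, GIVEN Wall's theorem**: from homeomorphic, non-diffeomorphic closed smooth `M`, `N` with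
`M` simply connected and `hW` (Wall 1964, Thm. 2) one gets `HCobordismBarrierFour`. The shape of
Donaldson's argument (1987, p. 142) with the pair left abstract.
[cite: DonaldsonIrrationality1987, p. 142] [cite: WallJLMS1964, Thm. 2] -/
theorem hCobordismBarrierFour_of_homeomorph_of_isEmpty_diffeomorph
    (hW : Literature.Topology.FourManifolds.isHCobordant_and_exists_isStabilization)
    (M N : Type) [TopologicalSpace M] [T2Space M] [SecondCountableTopology M]
    [ChartedSpace (EuclideanSpace ℝ (Fin 4)) M] [IsManifold (𝓡 4) ∞ M] [CompactSpace M]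
    [SimplyConnectedSpace M] [TopologicalSpace N] [T2Space N] [SecondCountableTopology N]
    [ChartedSpace (EuclideanSpace ℝ (Fin 4)) N]
    [IsManifold (𝓡 4) ∞ N] [CompactSpace N] (e : M ≃ₜ N) (hE : IsEmpty (M ≃ₘ⟮𝓡 4, 𝓡 4⟯ N)) :
    HCobordismBarrierFour :=
  hCobordismBarrierFour_of_donaldson
    (exists_isHCobordant_isEmpty_diffeomorph_four_of_homeomorph hW M N e hE)

/-- **A second derivation of the barrier from tree facts: Wall 1964 + Akhmedov–Park 2010.** GIVEN
Wall's Thm. 2 (`hW`) and the Akhmedov–Park family (`hAP`, sibling entry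
`SmallExoticaFrontier.lean`: closed smooth `N₀, N₁, …` homeomorphic to a simply connected closed
smooth `M` with `H₂(M; ℤ) ≅ ℤ³`, pairwise non-diffeomorphic [Akhmedov–Park 2010, Thm. 1 (i)]), the
pair `(N₀, N₁)` is homeomorphic (through `M`), simply connected and not diffeomorphic (`0 ≠ 1`),
so `hCobordismBarrierFour_of_homeomorph_of_isEmpty_diffeomorph` applies. Thus the barrier does not
depend on Donaldson's particular pair: any gauge-theoretic exotic pair will do.
[cite: AkhmedovPark2010, Thm. 1 (i)] [cite: WallJLMS1964, Thm. 2]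
[cite: DonaldsonIrrationality1987, p. 142] -/
theorem hCobordismBarrierFour_of_wall_of_akhmedovPark
    (hW : Literature.Topology.FourManifolds.isHCobordant_and_exists_isStabilization)
    (hAP : akhmedovPark2010_exotic_bTwo_three) : HCobordismBarrierFour := by
  obtain ⟨M, _, _, _, _, _, _, _, N, _, _, _, _, _, _, -, hN, hinj⟩ := hAP
  obtain ⟨e0⟩ := hN 0
  obtain ⟨e1⟩ := hN 1
  haveI : SimplyConnectedSpace (N 0) := e0.toHomotopyEquiv.simplyConnectedSpace
  refine hCobordismBarrierFour_of_homeomorph_of_isEmpty_diffeomorph hW (N 0) (N 1)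
    (e0.trans e1.symm) ⟨fun d => ?_⟩
  exact absurd (hinj 0 1 ⟨d⟩) zero_ne_one

/-! ### The barrier and the two leaves of Donaldson's counterexample: Wall's Thm. 2, an exotic pair -/

/-- **The barrier from the two finest leaves of the tree's decomposition of Donaldson's
counterexample**: GIVEN Wall 1964, Thm. 2 alone (`hW`:
`Literature.Topology.FourManifolds.isHCobordant_of_equivalent_intersectionForm` — simply connected closed smooth
4-manifolds with isometric intersection forms are smoothly h-cobordant) and an exotic pair of
simply connected closed smooth 4-manifolds (`hE`:
`Literature.Topology.FourManifolds.exists_homeomorph_isEmpty_diffeomorph_four` — Donaldson 1987, Prop. (3.16)(ii) and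
Thm. (3.24) in existence form), the smooth h-cobordism principle fails in dimension 4. The
assembly `(A) → (B) → exists_isHCobordant_isEmpty_diffeomorph_four` is the tree theorem
`Literature.Topology.FourManifolds.exists_isHCobordant_isEmpty_diffeomorph_four_of`; this is Donaldson's own inference,
p. 142: "Wall showed in [30] that there is an h-cobordism between two simply connected, homotopy
equivalent 4-manifolds. So `Z` and `P² # 9P̄²` are h-cobordant nondiffeomorphic manifolds and they
give a counterexample to the 'h-cobordism conjecture' for smooth 4-manifolds."
[cite: DonaldsonIrrationality1987, p. 142 with Prop. (3.16)(ii) p. 159 and Thm. (3.24) p. 163]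
[cite: WallJLMS1964, Thm. 2 (p. 141)] -/
theorem hCobordismBarrierFour_of_wallThmTwo_of_exoticPair
    (hW : Literature.Topology.FourManifolds.isHCobordant_of_equivalent_intersectionForm)
    (hE : Literature.Topology.FourManifolds.exists_homeomorph_isEmpty_diffeomorph_four) :
    HCobordismBarrierFour :=
  hCobordismBarrierFour_of_donaldson
    (Literature.Topology.FourManifolds.exists_isHCobordant_isEmpty_diffeomorph_four_of hW hE)

/-- **A proof of the barrier yields an exotic pair, GIVEN Freedman's h-cobordism theorem** (tree
fact `Literature.Topology.FourManifolds.nonempty_homeomorph_of_isHCobordant_four`, hypothesis `hF`: simply connected closed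
smooth h-cobordant 4-manifolds are homeomorphic; Freedman 1982, Thm. 1.3, Freedman–Quinn
Thm. 7.1A). From `HCobordismBarrierFour` one extracts an h-cobordant non-diffeomorphic pair
(`HCobordismBarrierFour.exists_isHCobordant_isEmpty_diffeomorph`), which `hF` makes homeomorphic
(`Literature.Topology.FourManifolds.exists_homeomorph_isEmpty_diffeomorph_four_of_freedman`): "Of course, by Freedman's
classification [11] the two manifolds are homeomorphic" (Donaldson 1987, p. 142).
[cite: DonaldsonIrrationality1987, p. 142] [cite: FreedmanJDG1982, Thm. 1.3 (p. 363)] -/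
theorem HCobordismBarrierFour.exists_homeomorph_isEmpty_diffeomorph_of_freedman
    (h : HCobordismBarrierFour)
    (hF : Literature.Topology.FourManifolds.nonempty_homeomorph_of_isHCobordant_four.{0}) :
    Literature.Topology.FourManifolds.exists_homeomorph_isEmpty_diffeomorph_four :=
  Literature.Topology.FourManifolds.exists_homeomorph_isEmpty_diffeomorph_four_of_freedman hF
    h.exists_isHCobordant_isEmpty_diffeomorph

/-- **Modulo Wall (1964, Thm. 2) and Freedman (1982, Thm. 1.3), the barrier IS the existence of an
exotic pair of simply connected closed smooth 4-manifolds.** GIVEN `hW` (Wall's Thm. 2,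
`Literature.Topology.FourManifolds.isHCobordant_of_equivalent_intersectionForm`) and `hF` (Freedman,
`Literature.Topology.FourManifolds.nonempty_homeomorph_of_isHCobordant_four`), `HCobordismBarrierFour` holds if and only if
there are simply connected closed smooth 4-manifolds which are homeomorphic and not diffeomorphic
(`Literature.Topology.FourManifolds.exists_homeomorph_isEmpty_diffeomorph_four`): compose
`hCobordismBarrierFour_iff_exists_isHCobordant_isEmpty_diffeomorph` with the tree's
`Literature.Topology.FourManifolds.exists_isHCobordant_isEmpty_diffeomorph_four_iff_exists_homeomorph`. This is the leaf
census of the unconditional discharge: what remains beyond the two classical theorems is exactly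
an exotic pair, whose every published construction is gauge-theoretic (Donaldson 1987, §§II–III:
the `Γ`-invariant of Thm. (2.15) and the stable-bundle computations Cor. (3.20), Thm. (3.21);
or Seiberg–Witten invariants, Akhmedov–Park 2010, Lemma 8).
[cite: DonaldsonIrrationality1987, p. 142, Thm. (2.15) p. 152 and Thm. (3.24) p. 163]
[cite: WallJLMS1964, Thm. 2 (p. 141)] [cite: FreedmanJDG1982, Thm. 1.3 (p. 363)] -/
theorem hCobordismBarrierFour_iff_exists_homeomorph_isEmpty_diffeomorph
    (hW : Literature.Topology.FourManifolds.isHCobordant_of_equivalent_intersectionForm)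
    (hF : Literature.Topology.FourManifolds.nonempty_homeomorph_of_isHCobordant_four.{0}) :
    HCobordismBarrierFour ↔ Literature.Topology.FourManifolds.exists_homeomorph_isEmpty_diffeomorph_four :=
  hCobordismBarrierFour_iff_exists_isHCobordant_isEmpty_diffeomorph.trans
    (Literature.Topology.FourManifolds.exists_isHCobordant_isEmpty_diffeomorph_four_iff_exists_homeomorph hW hF)

/-- **Given Wall's Thm. 2 and Freedman's theorem, the h-cobordism principle in dimension 4 says
exactly that there is NO exotic pair of simply connected closed smooth 4-manifolds** — i.e. that
homeomorphic simply connected closed smooth 4-manifolds are diffeomorphic (contrapositive form of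
`hCobordismBarrierFour_iff_exists_homeomorph_isEmpty_diffeomorph`). [cite: DonaldsonIrrationality1987, p. 142] -/
theorem hCobordismPrincipleFour_iff_not_exists_homeomorph_isEmpty_diffeomorph
    (hW : Literature.Topology.FourManifolds.isHCobordant_of_equivalent_intersectionForm)
    (hF : Literature.Topology.FourManifolds.nonempty_homeomorph_of_isHCobordant_four.{0}) :
    HCobordismPrincipleFour ↔ ¬ Literature.Topology.FourManifolds.exists_homeomorph_isEmpty_diffeomorph_four := by
  rw [← hCobordismBarrierFour_iff_exists_homeomorph_isEmpty_diffeomorph hW hF]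
  exact ⟨fun h hB => hB h, fun h => Classical.not_not.mp h⟩

/-! ### The Kervaire–Milnor side: only `Θ₄ = 0` remains as a hypothesis -/

/-- **GIVEN `Θ₄ = 0` (h-cobordism sense) alone, the h-cobordism principle in dimension 4 would
prove that every homotopy 4-sphere is diffeomorphic to `S⁴`.** The variant of
`HCobordismPrincipleFour.nonempty_diffeomorph_sphere` in which the hypothesis `π₁(S⁴) = 1` is
discharged by the tree theorem `Literature.Topology.FourManifolds.simplyConnectedSpace_sphere_four_holds` (Hatcher,
Prop. 1.14), so that the one remaining input is Kervaire–Milnor's `Θ₄ = 0`: every homotopy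
4-sphere is h-cobordant to `S⁴` (`hΘ`, tree fact `Literature.Topology.FourManifolds.isHCobordant_sphere_of_homotopySphere_four`).
In Kervaire–Milnor, *Groups of homotopy spheres I* (1963) this is the entry `n = 4 ↦ 1` of the
table of orders of `Θₙ` (p. 504), obtained in Part I from Thm. 3.1 (p. 508), §4 (p. 512:
`Θₙ / bPₙ₊₁ ↪ Πₙ / p(Sⁿ)`, with the table of these cokernels for `n ≤ 8`), Thm. 5.1 (p. 512:
`bP₂ₖ₊₁ = 0`, here `k = 2`) and Lemma 2.3 (p. 506); Thm. 1.1 (p. 504) is the group structure.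
[cite: KervaireMilnorAnnals1963, table p. 504 (Θ₄ = 0) via Thm. 5.1, §4 (p. 512) and Lemma 2.3 (p. 506)]
[cite: HatcherAT2002, Prop. 1.14] -/
theorem HCobordismPrincipleFour.nonempty_diffeomorph_sphere_of_thetaFour (h : HCobordismPrincipleFour)
    (hΘ : Literature.Topology.FourManifolds.isHCobordant_sphere_of_homotopySphere_four)
    (S : Literature.Topology.FourManifolds.HomotopySphere 4) :
    Nonempty (S.carrier ≃ₘ⟮𝓡 4, 𝓡 4⟯ (Metric.sphere (0 : EuclideanSpace ℝ (Fin 5)) 1)) :=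
  h.nonempty_diffeomorph_sphere hΘ Literature.Topology.FourManifolds.simplyConnectedSpace_sphere_four_holds S

/-- **Contrapositive on the Kervaire–Milnor side**: GIVEN `Θ₄ = 0` (`hΘ`), a single homotopy
4-sphere not diffeomorphic to `S⁴` (an exotic `S⁴` in the bundled form of the tree's
`Literature.Topology.FourManifolds.HomotopySphere 4`) would by itself refute the h-cobordism principle, i.e. prove
`HCobordismBarrierFour` — with a counterexample of the kind the printed ones (`b₂ = 10`, resp.
`b₂ = 3` for Akhmedov–Park) are not (`scope_caveats` (a) of the barrier).
[cite: KervaireMilnorAnnals1963, table p. 504 (Θ₄ = 0) and Lemma 2.3] [cite: DonaldsonIrrationality1987, p. 142] -/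
theorem hCobordismBarrierFour_of_isEmpty_diffeomorph_homotopySphere
    (hΘ : Literature.Topology.FourManifolds.isHCobordant_sphere_of_homotopySphere_four)
    (S : Literature.Topology.FourManifolds.HomotopySphere 4)
    (hS : IsEmpty (S.carrier ≃ₘ⟮𝓡 4, 𝓡 4⟯ (Metric.sphere (0 : EuclideanSpace ℝ (Fin 5)) 1))) :
    HCobordismBarrierFour := fun h =>
  (h.nonempty_diffeomorph_sphere_of_thetaFour hΘ S).elim fun e => hS.false e

end Literature.Barriers.SmoothPoincare4

end
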